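import Summits.QuantumFields.YangMills.Theorems.PoincareLipschitzSobolevChainRuleByApproximation
import Summits.QuantumFields.YangMills.Theorems.PoincareLipschitzSphereRayProjectionCalculus
import HarnessLib

/-!
# Crux `BlockLipschitzL` (stmt-QuantumFields-23533) ∕ `HistoryTailL` (stmt-QuantumFields-19936), LINE 25 «CompactnessTransfer»,
# S1″ row (C) — (C)-PROOF brick (C-b) «THE HKL PROJECTION OF A SOBOLEV MAP IS SOBOLEV» (knit of (C-b-α) px22 g7 ⊕ (C-b-β) this seat)

Cell `ym3-torus` (YM ladder rung R3 = continuum SU(2) Yang–Mills on T³ — a RUNG, NOT the Clay problem: not d = 4, not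
infinite volume, not a mass gap); WIDTH helper seat `ym-ust-19936-w3` g15; (C)-PROOF lineage project of seat w2 g13 (LEAD ★w1-19936
g10 «GO (C)-PROOF»).  Helper `--supports stmt-QuantumFields-23533`; THEOREMS ONLY (0 `def`, 0 `sorry`, default heartbeats); imports
✓`PoincareLipschitzSobolevChainRuleByApproximation` ((C-b-β), this seat) + px22 g7's ✓`PoincareLipschitzSphereRayProjectionCalculus`
((C-b-α): `π_p` smooth off `p`, `‖Dπ_p y‖ ≤ 6∕‖y − p‖`, `Dπ_p p = 0`, and the regularised family `N_ε` with an `ε`-uniform majorant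
`K∕‖y − p‖`, eventually-constant values and derivatives along `ε = 1∕(n+1)`).

THE BRICK [HardtKinderlehrerLin1986, §2]: the ray projection `π_p` (H-1's spelled-out map, centre `‖p‖ ≤ ½`) composed with a map `w`
having weak gradient `Gw` on `Ω` and `‖w − p‖⁻¹·‖Gw‖` locally integrable on `Ω` has weak gradient `Dπ_p(w) ∘ Gw` on `Ω`, with
energy density `≤ 36·dens(Gw)∕‖w − p‖²` — NO hypothesis on the fibre `{w = p}` (there both sides are the junk value `0`).

WHAT IS PROVED (ns `…Theorems.PoincareLipschitzSobolevRayProjectionComp`; `E` f.d. real inner-product Borel, `μ` additive Haar,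
`V` complete real inner-product space).
* ★★★ `hasWeakFDerivOn_rayProj_comp (hw : HasWeakFDerivOn Ω μ w Gw) (p) (hp : ‖p‖ ≤ 1∕2)
  (hInt : LocallyIntegrableOn (fun x => ‖w x − p‖⁻¹ * ‖Gw x‖) Ω μ) : HasWeakFDerivOn Ω μ (π_p ∘ w) (x ↦ Dπ_p(w x) ∘ Gw x)`.
* `norm_fderiv_rayProj_le_all` (`‖Dπ_p y‖ ≤ 6∕‖y − p‖` at every `y`), ★★ `dens_rayProj_comp_le` (on `ℝ³`:
  `Σᵢ‖(Dπ_p(w x) ∘ Gw x) eᵢ‖² ≤ (6∕‖w x − p‖)²·Σᵢ‖Gw x eᵢ‖²`).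
HONEST SCOPE.  A brick; (C) = `MinimisingMapCompactness` is NOT proved here ((C-a3), (C-d), (C-e) remain with w2's lineage);
(RS), S1″ (unconditionally), `hHalvingBand`, K1, `MeanDeviationL`, `BlockLipschitzL`, `HistoryTailL` NOT proved.  YM₃ on T³ is rung R3,
not Clay; YM gap NOT proved; no summit statement is proved here.

References: R. Hardt, D. Kinderlehrer, F.-H. Lin, Comm. Math. Phys. 105 (1986) 547–570 [HardtKinderlehrerLin1986] (§2); L. C. Evans,
R. F. Gariepy, Measure Theory and Fine Properties of Functions (1992) [EvansGariepy1992] (§4.2.2).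
-/

set_option autoImplicit false


noncomputable section

open MeasureTheory Set Function Filter Topology Metric TopologicalSpace
open scoped ContDiff ENNReal BigOperators InnerProductSpace RealInnerProductSpace

namespace Summit.QuantumFields.YangMills.Theorems.PoincareLipschitzSobolevRayProjectionComp

open Literature.Analysis.FunctionSpaces
open Summit.QuantumFields.YangMills.Theorems.PoincareLipschitzSobolevChainRuleByApproximation
  (hasWeakFDerivOn_comp_of_eventuallyEq_approx sum_norm_sq_comp_apply_le)
open Summit.QuantumFields.YangMills.Theorems.PoincareLipschitzSphereRayProjectionCalculus

variable {E : Type*} [NormedAddCommGroup E] [InnerProductSpace ℝ E] [FiniteDimensional ℝ E]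
  [MeasurableSpace E] [BorelSpace E] {μ : Measure E} [μ.IsAddHaarMeasure]
variable {V : Type*} [NormedAddCommGroup V] [InnerProductSpace ℝ V] [CompleteSpace V]

/-- ★★★ **THE HKL RAY PROJECTION OF A SOBOLEV MAP IS SOBOLEV**, with weak gradient `Dπ_p(w) ∘ Gw` (junk `0` on the fibre `{w = p}`):
if `w` has weak gradient `Gw` on `Ω` and `x ↦ ‖w x − p‖⁻¹·‖Gw x‖` is locally integrable on `Ω` (`‖p‖ ≤ ½`), then
`π_p ∘ w` has weak gradient `x ↦ Dπ_p(w x) ∘ Gw x` on `Ω` — ✓`hasWeakFDerivOn_comp_of_eventuallyEq_approx` fed with px22 g7's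
regularised family (✓`PoincareLipschitzSphereRayProjectionCalculus`). [cite: HardtKinderlehrerLin1986, §2; EvansGariepy1992, §4.2.2 Thm 4 (ii)] -/
theorem hasWeakFDerivOn_rayProj_comp {Ω : Opens E} {w : E → V} {Gw : E → E →L[ℝ] V}
    (hw : HasWeakFDerivOn Ω μ w Gw) (p : V) (hp : ‖p‖ ≤ 1 / 2)
    (hInt : LocallyIntegrableOn (fun x => ‖w x - p‖⁻¹ * ‖Gw x‖) (Ω : Set E) μ) :
    HasWeakFDerivOn Ω μ
      (fun x => p + (-⟪p, ‖w x - p‖⁻¹ • (w x - p)⟫ +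
        Real.sqrt (⟪p, ‖w x - p‖⁻¹ • (w x - p)⟫ ^ 2 + (1 - ‖p‖ ^ 2))) • (‖w x - p‖⁻¹ • (w x - p)))
      (fun x => (fderiv ℝ (fun y : V => p + (-⟪p, ‖y - p‖⁻¹ • (y - p)⟫ +
        Real.sqrt (⟪p, ‖y - p‖⁻¹ • (y - p)⟫ ^ 2 + (1 - ‖p‖ ^ 2))) • (‖y - p‖⁻¹ • (y - p))) (w x)).comp (Gw x)) := by
  obtain ⟨K, hK0, hK⟩ := exists_norm_fderiv_smoothRayProj_le p hp
  have hpos : ∀ n : ℕ, (0 : ℝ) < 1 / ((n : ℝ) + 1) := fun n => by positivity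
  refine hasWeakFDerivOn_comp_of_eventuallyEq_approx (μ := μ) hw
    (P := fun y : V => p + (-⟪p, ‖y - p‖⁻¹ • (y - p)⟫ +
        Real.sqrt (⟪p, ‖y - p‖⁻¹ • (y - p)⟫ ^ 2 + (1 - ‖p‖ ^ 2))) • (‖y - p‖⁻¹ • (y - p)))
    (N := fun n (y : V) => p + Real.smoothTransition (‖y - p‖ ^ 2 / (1 / ((n:ℝ) + 1)) ^ 2 - 1) •
      ((-⟪p, ‖y - p‖⁻¹ • (y - p)⟫ + Real.sqrt (⟪p, ‖y - p‖⁻¹ • (y - p)⟫ ^ 2 + (1 - ‖p‖ ^ 2))) • (‖y - p‖⁻¹ • (y - p))))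
    (fun n => contDiff_smoothRayProj p hp (hpos n)) (fun n => exists_norm_fderiv_smoothRayProj_le_const p hp (hpos n))
    (B := 3) (fun n y => norm_smoothRayProj_le p y hp _) (fun y => eventually_smoothRayProj_eq p y)
    (fun y => eventually_fderiv_smoothRayProj_eq p y hp) (M := fun y => K / ‖y - p‖) (fun n y => hK _ (hpos n) y) ?_
  -- the majorant `K∕‖w − p‖ · ‖Gw‖ = K · (‖w − p‖⁻¹‖Gw‖)` is locally integrable
  have hfun : (fun x => K / ‖w x - p‖ * ‖Gw x‖) = K • fun x => ‖w x - p‖⁻¹ * ‖Gw x‖ := by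
    funext x
    simp only [Pi.smul_apply, smul_eq_mul, div_eq_mul_inv, mul_assoc]
  rw [hfun]
  exact hInt.smul K

omit [CompleteSpace V] in
/-- The operator-norm majorant `‖Dπ_p y‖ ≤ 6∕‖y − p‖` at EVERY `y` (at the centre both sides vanish: junk `fderiv = 0`, `6∕0 = 0`).
[cite: HardtKinderlehrerLin1986, §2] -/
theorem norm_fderiv_rayProj_le_all (p : V) (hp : ‖p‖ ≤ 1 / 2) (y : V) :
    ‖fderiv ℝ (fun y : V => p + (-⟪p, ‖y - p‖⁻¹ • (y - p)⟫ +
        Real.sqrt (⟪p, ‖y - p‖⁻¹ • (y - p)⟫ ^ 2 + (1 - ‖p‖ ^ 2))) • (‖y - p‖⁻¹ • (y - p))) y‖ ≤ 6 / ‖y - p‖ := by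
  by_cases hy : y = p
  · subst hy
    rw [fderiv_rayProj_centre y hp, norm_zero, sub_self, norm_zero, div_zero]
  · exact norm_fderiv_rayProj_le p y hp hy

omit [CompleteSpace V] in
/-- ★★ **THE ENERGY DENSITY OF THE PROJECTED MAP**: on `ℝ³`, `Σᵢ‖(Dπ_p(w x) ∘ Gw x) eᵢ‖² ≤ (6∕‖w x − p‖)²·Σᵢ‖Gw x eᵢ‖²`
(`= 36·dens(Gw)∕‖w − p‖²` off the fibre, `0 ≤ 0` on it). [cite: HardtKinderlehrerLin1986, §2] -/
theorem dens_rayProj_comp_le (p : V) (hp : ‖p‖ ≤ 1 / 2) {w : EuclideanSpace ℝ (Fin 3) → V}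
    {Gw : EuclideanSpace ℝ (Fin 3) → EuclideanSpace ℝ (Fin 3) →L[ℝ] V} (x : EuclideanSpace ℝ (Fin 3)) :
    ∑ i : Fin 3, ‖((fderiv ℝ (fun y : V => p + (-⟪p, ‖y - p‖⁻¹ • (y - p)⟫ +
        Real.sqrt (⟪p, ‖y - p‖⁻¹ • (y - p)⟫ ^ 2 + (1 - ‖p‖ ^ 2))) • (‖y - p‖⁻¹ • (y - p))) (w x)).comp (Gw x))
        (EuclideanSpace.single i (1:ℝ))‖ ^ 2 ≤
      (6 / ‖w x - p‖) ^ 2 * ∑ i : Fin 3, ‖Gw x (EuclideanSpace.single i (1:ℝ))‖ ^ 2 :=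
  sum_norm_sq_comp_apply_le (Finset.univ : Finset (Fin 3)) (fun i => EuclideanSpace.single i (1:ℝ))
    (M' := fun y => 6 / ‖y - p‖) (norm_fderiv_rayProj_le_all p hp) x

end Summit.QuantumFields.YangMills.Theorems.PoincareLipschitzSobolevRayProjectionComp

end
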